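import Mathlib
import Literature.RingTheory.MvPowerSeries.OptionEquivLeft
import HarnessLib

/-!
# Coefficients of products of power series in separated variables (CDT §2.2)

`Literature/RingTheory/MvPowerSeries/SeparatedVariablesProduct.lean`. Everything here is PROVED
(no definition, no named fact). For one-variable power series `g_s ∈ R⟦T⟧` placed in distinct
variables `x_s`, the coefficient of `x^n` in `∏_s g_s(x_s)` is `∏_s [T^{n_s}] g_s`
(`coeff_prod_toMvPowerSeries`), and hence for a finite linear combination
`H = ∑_J a_J ∏_s u_{J,s}(x_s)` one has `[x^n] H = ∑_J a_J ∏_s [T^{n_s}] u_{J,s}`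
(`coeff_sum_smul_prod_toMvPowerSeries`). This is the formal identity behind the display
"Since the `𝐳ⁿ` coefficient is also computed by Cauchy's integral formula …" in F. Calegari,
V. Dimitrov, Y. Tang, *The unbounded denominators conjecture* (J. Amer. Math. Soc. **38**
(2025), 627–702), §2.2: their auxiliary function `H(𝐳) = h(z₁)^D ⋯ h(z_d)^D · F(φ(z₁), …, φ(z_d))`
"expands … into a `ℤ`-linear combination of `(mD)^d` terms" each of which is a product of
one-variable functions, so its `𝐳ⁿ`-coefficient is the corresponding combination of products of
one-variable Taylor coefficients — the quantity bounded in
`Literature.Analysis.Complex.norm_sum_prod_taylorCoeff_le`. [folklore]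

## References

* [CalegariDimitrovTang2025] F. Calegari, V. Dimitrov, Y. Tang, The unbounded denominators
  conjecture, J. Amer. Math. Soc. 38 (2025), no. 3, 627–702, §2.2 (proof of Lemma 2.0.4).
-/

noncomputable section

open Finset MvPowerSeries

namespace Literature.RingTheory.MvPowerSeries

variable {σ : Type*} [Fintype σ] [DecidableEq σ] {R : Type*} [CommRing R]

/-- **Coefficients of a product in separated variables**: for `g : σ → R⟦T⟧`,
`[x^n] ∏_s g_s(x_s) = ∏_s [T^{n_s}] g_s`. [folklore] -/
theorem coeff_prod_toMvPowerSeries (g : σ → PowerSeries R) (n : σ →₀ ℕ) :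
    MvPowerSeries.coeff n (∏ s, ((g s).toMvPowerSeries s : MvPowerSeries σ R)) =
      ∏ s, PowerSeries.coeff (n s) (g s) := by
  rw [MvPowerSeries.coeff_prod]
  -- the only contributing decomposition of `n` is `l₀ s = n_s e_s`
  set l₀ : σ →₀ (σ →₀ ℕ) := Finsupp.equivFunOnFinite.symm (fun s ↦ Finsupp.single s (n s))
    with hl₀
  have hl₀app : ∀ s, l₀ s = Finsupp.single s (n s) := fun s ↦ by simp [hl₀]
  have hl₀mem : l₀ ∈ (univ : Finset σ).finsuppAntidiag n := by
    rw [mem_finsuppAntidiag]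
    refine ⟨?_, by simp⟩
    simp_rw [hl₀app]
    -- the multi-index `(n_s e_s)_s` sums to `n` (Mathlib: `Finsupp.univ_sum_single`)
    exact Finsupp.univ_sum_single n
  rw [Finset.sum_eq_single l₀]
  · refine prod_congr rfl fun s _ ↦ ?_
    rw [hl₀app, coeff_toMvPowerSeries]
    simp
  · -- every other decomposition has a factor whose multi-index is not supported on its variable
    intro l hl hne
    rw [mem_finsuppAntidiag] at hl
    by_contra hprod
    apply hne
    have hall : ∀ s, l s = Finsupp.single s (l s s) := by
      intro s
      by_contra hs
      apply hprod
      apply Finset.prod_eq_zero (Finset.mem_univ s)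
      rw [coeff_toMvPowerSeries, if_neg hs]
    apply Finsupp.ext
    intro t
    rw [hl₀app]
    have hnt : n t = l t t := by
      have h1 := congrArg (fun e : σ →₀ ℕ ↦ e t) hl.1
      simp only [Finset.sum_apply'] at h1
      rw [← h1, Finset.sum_eq_single t]
      · intro s _ hst
        rw [hall s, Finsupp.single_apply, if_neg hst]
      · intro ht; exact absurd (Finset.mem_univ t) ht
    rw [hall t, hnt]
  · intro h; exact absurd hl₀mem h

/-- **Coefficients of a decomposable series**: for `H = ∑_{j ∈ J} a_j ∏_s u_{j,s}(x_s)`,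
`[x^n] H = ∑_j a_j ∏_s [T^{n_s}] u_{j,s}`. [folklore] -/
theorem coeff_sum_smul_prod_toMvPowerSeries {ι : Type*} (J : Finset ι) (a : ι → R)
    (u : ι → σ → PowerSeries R) (n : σ →₀ ℕ) :
    MvPowerSeries.coeff n (∑ j ∈ J, a j • ∏ s, ((u j s).toMvPowerSeries s : MvPowerSeries σ R)) =
      ∑ j ∈ J, a j * ∏ s, PowerSeries.coeff (n s) (u j s) := by
  rw [map_sum]
  refine sum_congr rfl fun j _ ↦ ?_
  rw [map_smul, coeff_prod_toMvPowerSeries, smul_eq_mul]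

end Literature.RingTheory.MvPowerSeries
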